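import Summits.CriticalPhenomena.PercolationContinuityZ3.Theorems.PercNearOneGluingNoHeavyPcintLoopExclusionSiteFirstRung
import Summits.CriticalPhenomena.PercolationContinuityZ3.Theorems.PercNearOneGluingNoHeavyPcintNawMemoryFour
import Summits.CriticalPhenomena.PercolationContinuityZ3.Theorems.PercNearOneGluingNoHeavyPcintMemoryFourRecursion
import HarnessLib

/-!
# CriticalPhenomena/PercolationContinuityZ3 — Theorems/PercNearOneGluingNoHeavyPcintNawMemoryThree.lean: neighbour-avoidance memory `3` IS the tree's `IsNAWFour` (no reversal, no U-turn) — via "three unit steps sum to a unit step only with a cancellation"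

Lane prim-pcint, STRUCTURE rule; a lemma file for …PcintNawMemoryFourExact (`μ^N_4 = λ_d` exactly); imports …PcintLoopExclusionSiteFirstRung
(for `isNawMem_two_iff`, `not_adj_wordPos_of_even`) and the tree's …PcintNawMemoryFour.  The typed site hierarchy
(…PcintNawMemoryTail: `IsNawMem τ`, `nawMemWords`, `nawMemGrowth`) at memory `3` (= memory `4`, `nawMemGrowth_even_eq`) coincides
with the tree's combinatorial class `IsNAWFour` of …PcintNawMemoryFour:

* (the unit-step dot-product lemmas and **`MemoryTail.cancel_of_three_steps`** — if `e_a + e_b + e_c = e_e` then `b = −a` or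
  `c = −b` or `c = −a` — now live in …PcintMemoryFourFisherSykes, which this file imports);
* **`isNawMem_three_iff_isNAWFour`**, `nawMemWords_three_eq_nawFourWords` — so every count bound for `nawFourWords` is a
  statement about `nawMemCount d 3` and the typed `μ^N_3 = μ^N_4`;
* `closingNawCount_four_ge` — `2·4·p^N_4(ℤ^d) ≥ 2d(2d−2)` (the opened unit squares `(a, b, −a)`, `b ⟂ a`, are closing
  memory-2 words), the lower count used for `R^N_4 < 1` in …PcintNawMemoryFourExact.

HONEST FRAMING: elementary.  Written by prim-pcint-2 gen 16 (prover-prim-pcint-2-g16-0), 2026-08-24.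
-/

noncomputable section

open Matrix
open Literature.Probability.LatticeModels Literature.Probability.Percolation
open Summit.CriticalPhenomena.PercolationContinuityZ3.Theorems.Pcint

namespace Summit.CriticalPhenomena.PercolationContinuityZ3.Theorems.Pcint.NawTail

variable {d : ℕ}



/-- **Neighbour-avoidance memory `3` is exactly the tree's `IsNAWFour`** (no reversal, no `(a, b, −a)`): the gap-`1`/`3`
coincidences and the gap-`2` adjacency are void by parity, a gap-`2` coincidence is a reversal, and a gap-`3` adjacency
`ω(i+3) ∼ ω(i)` means `e_a + e_b + e_c` is a unit step, i.e. (`cancel_of_three_steps`) a reversal or a U-turn. [folklore] -/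
theorem isNawMem_three_iff_isNAWFour {n : ℕ} (w : Fin n → Fin d × Bool) : IsNawMem 3 w ↔ IsNAWFour w := by
  constructor
  · intro h
    refine ⟨fun k hk hrev => (h k (k + 2) (by omega) (by omega) (by omega)).1 (wordPos_add_two_of_srev w hk hrev).symm,
      fun k hk hrev => (h k (k + 3) (by omega) (by omega) (by omega)).2 (by omega) ?_⟩
    rw [wordPos_add_three_of_srev w hk hrev]
    exact (zdGraph_adj_iff_stepVec _ _).2 ⟨_, rfl⟩
  · rintro ⟨hrev, hut⟩ i j hj hij hτ
    have h1 : ∀ k (hk : k < n), wordPos w (k + 1) = wordPos w k + stepVec (w ⟨k, hk⟩) := fun k hk => wordPos_succ w hk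
    rcases (by omega : j = i + 1 ∨ j = i + 2 ∨ j = i + 3) with rfl | rfl | rfl
    · exact ⟨MemoryTail.wordPos_ne_of_odd w (by omega) hj (by omega), fun h2 => by omega⟩
    · refine ⟨fun heq => ?_, fun _ => not_adj_wordPos_of_even w (by omega) hj (by omega)⟩
      rw [show i + 2 = (i + 1) + 1 from rfl, h1 (i + 1) (by omega), h1 i (by omega), add_assoc] at heq
      have h0 : stepVec (w ⟨i, by omega⟩) + stepVec (w ⟨i + 1, by omega⟩) = 0 := left_eq_add.mp heq
      have : stepVec (w ⟨i + 1, by omega⟩) = stepVec (srev (w ⟨i, by omega⟩)) := by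
        rw [stepVec_srev]; exact eq_neg_of_add_eq_zero_right h0
      exact hrev i (by omega) (GMStep.stepVec_injective d this)
    · refine ⟨MemoryTail.wordPos_ne_of_odd w (by omega) hj (by omega), fun _ hadj => ?_⟩
      obtain ⟨e, he⟩ := (zdGraph_adj_iff_stepVec _ _).1 hadj
      rw [show i + 3 = ((i + 1) + 1) + 1 from rfl, h1 (i + 2) (by omega), h1 (i + 1) (by omega), h1 i (by omega),
        add_assoc, add_assoc] at he
      have h3' : stepVec (w ⟨i, by omega⟩) + (stepVec (w ⟨i + 1, by omega⟩) + stepVec (w ⟨i + 2, by omega⟩)) =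
          stepVec e := add_left_cancel he
      have h3 : stepVec (w ⟨i, by omega⟩) + stepVec (w ⟨i + 1, by omega⟩) + stepVec (w ⟨i + 2, by omega⟩) = stepVec e := by
        rw [add_assoc]; exact h3'
      rcases MemoryTail.cancel_of_three_steps h3 with h | h | h
      · exact hrev i (by omega) h
      · exact hrev (i + 1) (by omega) h
      · exact hut i (by omega) h





/-- `nawMemWords d 3 n = nawFourWords d n`. [folklore] -/
theorem nawMemWords_three_eq_nawFourWords (d n : ℕ) : nawMemWords d 3 n = nawFourWords d n := by
  classical
  ext w
  rw [mem_nawMemWords, mem_nawFourWords]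
  exact isNawMem_three_iff_isNAWFour w

/-- **`2·4·p^N_4(ℤ^d) ≥ 2d(2d−2)`**: the opened unit squares `(a, b, −a)`, `b ⟂ a`, are closing memory-2 words (in fact all of
them). [folklore] -/
theorem closingNawCount_four_ge (hd : 2 ≤ d) : 2 * d * (2 * d - 2) ≤ closingNawCount d 4 := by
  classical
  -- domain: pairs (a, b) on different axes
  set D := (Finset.univ : Finset (Fin d × Bool)).sigma fun a => Finset.univ.filter fun b : Fin d × Bool => b.1 ≠ a.1 with hD
  have hDcard : D.card = 2 * d * (2 * d - 2) := by
    rw [hD, Finset.card_sigma]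
    have hinner : ∀ a : Fin d × Bool, (Finset.univ.filter fun b : Fin d × Bool => b.1 ≠ a.1).card = 2 * d - 2 := by
      intro a
      have hcompl : (Finset.univ.filter fun b : Fin d × Bool => b.1 ≠ a.1) =
          Finset.univ \ {(a.1, true), (a.1, false)} := by
        ext b
        obtain ⟨j, s⟩ := b
        cases s <;> simp [eq_comm]
      rw [hcompl, Finset.card_sdiff_of_subset (Finset.subset_univ _), Finset.card_univ, Fintype.card_prod, Fintype.card_fin,
        Fintype.card_bool, Finset.card_pair (by simp)]
      omega
    simp_rw [hinner, Finset.sum_const, Finset.card_univ, Fintype.card_prod, Fintype.card_fin, Fintype.card_bool, smul_eq_mul]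
    ring
  rw [← hDcard]
  unfold closingNawCount
  -- the map (a, b) ↦ (a, b, −a)
  let F : (Σ _ : Fin d × Bool, Fin d × Bool) → (Fin 3 → Fin d × Bool) := fun p i =>
    if i.val = 0 then p.1 else if i.val = 1 then p.2 else srev p.1
  refine Finset.card_le_card_of_injOn F (fun p hp => ?_) (fun p hp p' hp' h => ?_)
  · rw [Finset.mem_coe, hD, Finset.mem_sigma, Finset.mem_filter] at hp
    obtain ⟨a, b⟩ := p
    have hab : b.1 ≠ a.1 := hp.2.2
    rw [Finset.mem_coe]
    show F ⟨a, b⟩ ∈ (nawMemWords d 2 3).filter fun w => (zdGraph d).Adj 0 (wordPos w 3)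
    have p1 : wordPos (F ⟨a, b⟩) 1 = stepVec a := by simpa [F] using wordPos_succ (F ⟨a, b⟩) (k := 0) (by omega)
    have p2 : wordPos (F ⟨a, b⟩) 2 = stepVec a + stepVec b := by
      have := wordPos_succ (F ⟨a, b⟩) (k := 1) (by omega); rw [p1] at this; simpa [F] using this
    have p3 : wordPos (F ⟨a, b⟩) 3 = stepVec b := by
      have := wordPos_succ (F ⟨a, b⟩) (k := 2) (by omega); rw [p2] at this
      simp only [F, show ¬ (2 : ℕ) = 0 from by omega, show ¬ (2 : ℕ) = 1 from by omega, if_false, stepVec_srev] at this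
      rw [this]; abel
    rw [Finset.mem_filter, mem_nawMemWords, isNawMem_two_iff]
    refine ⟨MemoryTail.isMem_two_of_isNBW ?_, ?_⟩
    · -- no immediate reversal: b ≠ −a (different axes) and −a ≠ −b
      intro k hk
      have hk2 : k ≤ 1 := by omega
      interval_cases k
      · simp only [F]; intro h; simp [srev] at h; exact hab (by rw [h])
      · simp only [F]; intro h; simp [srev] at h; exact hab (by obtain ⟨h1, -⟩ := h; exact h1.symm ▸ rfl)
    · rw [p3]; exact (zdGraph_adj_iff_stepVec _ _).2 ⟨b, by rw [zero_add]⟩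
  · have h0 := congrFun h ⟨0, by omega⟩
    have h1 := congrFun h ⟨1, by omega⟩
    simp only [F, if_true, show ¬ (1 : ℕ) = 0 from by omega, if_false] at h0 h1
    exact Sigma.ext h0 (heq_of_eq h1)

end Summit.CriticalPhenomena.PercolationContinuityZ3.Theorems.Pcint.NawTail
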